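import Summits.QuantumFields.YangMills.Theorems.UnitScaleTiltHalvingHSiteTopKnit
import Literature.MathematicalPhysics.QuantumFieldTheory.Balaban1983to89.B8CubeMemberLamBPrimeLaws
import HarnessLib

/-!
# `hP1room` PROGRAMME — EDITION γ, composers v3.1 (ym-ust-20520-w5 g9's LOCATE-2 §2: the ∀`g′`-closed residual `H42topCrossL` is uninhabitable; cure: datum-closed
# residual + the knit predicate on ALL boxes of PRINT's top class): ★ THE TOP-KNIT CLAUSE ON EVERY BOX OF `cubeLamBP′ … k k k` (collar bonds included)

Route `UnitScaleTilt`, crux K1 child «MinimiserStabilityRegPr» (stmt-QuantumFields-19200), registered stub `stub_halvingStep` (`BirthV10`).  Cell `ym3-torus` (HUMAN RULING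
D-0037: YM₃ on T³ is ladder rung R3 — NOT d = 4, NOT infinite volume, NOT a mass gap, NOT the Clay problem), width seat `ym-ust-19200-w3` gen 9.  `--supports
stmt-QuantumFields-19200 --as helper`; THEOREMS ONLY (0 `def`, 0 `sorry`); count-neutral; nothing here claims any socket, the stub, the crux or the gap.

WHAT.  ★ `hknit_of_descent_BP'` = ✓p655738 `HalvingHSiteTopKnit.hknit_of_descent` (the gauge-fixed datum field `W^{λ′}` equals `(U♯)^{g′}` lifted, `g′ := ((u₁·e^{iλ′})∘rep)⁻¹·ĝJ`,
on both bonds of every top block's box) with the top bond ranging over PRINT's split class `cubeLamBP′ L a M′ ρ′ k k k` ([Balaban1984PropagatorsII] (2.3): at least one end in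
`□^{(k)}`) instead of the inner class `cubeLamB … k k k` (both ends in `□^{(k)}`).  Proof = ✓p655738's: its engine ✓`gaugeActT_descent_eq_of_mgauge_cube` needs only `y, y + e_τ ∈ □₀`,
and the box of a bond of the split class lies in `□_{k−1} ⊆ □₀` by lit ✓`B8CubeMemberLamBPrimeLaws.cubeLamBP'_hbox_pred` («box ⊂ Ω_{j−1}», needs `L ≤ ρ′`) and ✓`cube_anti`.
So the γ composers v3.1 can take T4γ's knit predicate `Q V := ∀ c ∈ cubeLamBP′ … k k k, <V = (U♯)^{g′₀} on box c>` (the collar boxes included), which is what pins the exponent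
`A′` of the (1.42) residual on the collar bonds (ym-ust-20520-w5 g9 LOCATE-2 §1–§3).  HONEST SCOPE: an identity; nothing of Prop. 3 or the stub is proved here.

References: T. Bałaban, CMP **99** (1985) 75–102 [Balaban1985RegularSpaces] ((1.31) p.82, (1.68)–(1.69) p.88, (1.131) p.99); CMP **96** (1984) 223–250
[Balaban1984PropagatorsII] ((2.3) p.224); CMP **102** (1985) 277–309 [Balaban1985Variational] ((152) p.301).
-/

set_option autoImplicit false

noncomputable section

open scoped BigOperators Matrix.Norms.L2Operator
open NormedSpace
open Complex (I)

namespace Summit.QuantumFields.YangMills.Theorems.HalvingHSiteTopKnitBP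

open Literature.MathematicalPhysics.QuantumFieldTheory.Balaban1983to89
open Literature.MathematicalPhysics.QuantumFieldTheory.Balaban1983to89.T3ContinuumYM3Torus
open B5Eq118OneStroke (iterBlockOf)
open B7Prop1Explicit renaming Site → LSite
open B7Prop1Explicit (e)
open B7Prop2Explicit (unitaryUnits)
open B7Prop1Local (InBox loK bondHiK)
open B7Eq92Concrete (mgauge)
open B8Eq131Cubes (cube gs cube_anti)
open B8Eq131CubesAdmissible (cubeFam cubeFam_false_of_le)
open B9SupplySockB9P3ZdGamma (cubeLamBP')
open B8CubeMemberLamBPrimeLaws (cubeLamBP'_hbox_pred)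
open B8Eq184Proof (gaugeExp)
open B10Eq27TorusAxialLog (rel pull unitsField toUField suIncl gaugeActT)
open B15Eq112TorusCover (lift cover)
open P1FlatCoreCubeInclusion (transl_zero_eq_cover)
open HalvingP1FlatCoreTopSizes (datumGuards_gaugeFixed)
open HalvingHSiteTopKnit (gaugeActT_descent_eq_of_mgauge_cube)

variable {F : T3Family} {n K : ℕ}

/-- ★ **THE TOP-KNIT CLAUSE ON EVERY BOX OF PRINT's TOP CLASS `cubeLamBP′ … k k k`** (collar bonds included; `L ≤ ρ′`): `W^{λ′} y τ = (U♯)^{g′} ⟨cover y, τ⟩` for both bonds of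
the box of every `c ∈ cubeLamBP′ L a M′ ρ′ (K−n) (K−n) (K−n)`. [cite: Balaban1985RegularSpaces, (1.31) p.82, (1.68)-(1.69) p.88, (1.131) p.99; Balaban1984PropagatorsII, (2.3) p.224; Balaban1985Variational, (152) p.301] -/
theorem hknit_of_descent_BP' (x₀ : Site (F.P K) 0) {a : LSite (F.P K).d} {M' ρ' : ℕ} (hρ' : (F.P K).L ≤ ρ')
    (ha : ∀ ν, a ν ≤ ((iterBlockOf (K - n) x₀ ν).val : ℤ) ∧ ((iterBlockOf (K - n) x₀ ν).val : ℤ) ≤ a ν + M' - 1)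
    (hroomW : 2 * ((F.P K).L ^ (K - n) * (M' + 1) + ρ' * gs (F.P K).L (K - n)) ≤ (F.P K).sitesPerDir 0)
    (U : GaugeField (F.P K) 0 (Matrix.specialUnitaryGroup (Fin 2) ℂ)) (gJ : GaugeTransf (F.P K) 0 (Matrix.specialUnitaryGroup (Fin 2) ℂ))
    {u₁ : LSite (F.P K).d → (Matrix (Fin 2) (Fin 2) ℂ)ˣ} {W : LSite (F.P K).d → Fin (F.P K).d → (Matrix (Fin 2) (Fin 2) ℂ)ˣ}
    (hu₁ : ∀ x, u₁ x ∈ unitaryUnits (Matrix (Fin 2) (Fin 2) ℂ))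
    (hW : mgauge (1 : LSite (F.P K).d → Fin (F.P K).d → (Matrix (Fin 2) (Fin 2) ℂ)ˣ) u₁ W = pull (unitsField (toUField (GaugeField.gaugeAct gJ U))) 0)
    {lam : LSite (F.P K).d → Matrix (Fin 2) (Fin 2) ℂ} (hsa : ∀ x, IsSelfAdjoint (lam x)) :
    ∀ c ∈ cubeLamBP' (F.P K).L a M' ρ' (K - n) (K - n) (K - n), ∀ (y : LSite (F.P K).d) (τ : Fin (F.P K).d),
      InBox (loK (F.P K).L (K - n) c.1) (bondHiK (F.P K).L (K - n) c.1 c.2) y →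
      InBox (loK (F.P K).L (K - n) c.1) (bondHiK (F.P K).L (K - n) c.1 c.2) (y + e τ) →
        mgauge (1 : LSite (F.P K).d → Fin (F.P K).d → (Matrix (Fin 2) (Fin 2) ℂ)ˣ) (gaugeExp lam)⁻¹ W y τ =
          gaugeActT (fun s => ((u₁ * gaugeExp lam) (lift (F.P K) x₀ + rel x₀ s))⁻¹ * Unitary.toUnits (suIncl (gJ s)) :
            GaugeTransf (F.P K) 0 (Matrix (Fin 2) (Fin 2) ℂ)ˣ) (unitsField (toUField U)) ⟨cover (F.P K) y, τ⟩ := by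
  letI : CStarAlgebra (Matrix (Fin 2) (Fin 2) ℂ) := {}
  intro c hc y τ hy hyτ
  have hL1 : 1 ≤ (F.P K).L := (F.P K).L_pos
  -- the full gauge `u₁·e^{iλ′}` carries the gauge-fixed datum field to `U′`
  have hWV := (datumGuards_gaugeFixed (1 : LSite (F.P K).d → Fin (F.P K).d → (Matrix (Fin 2) (Fin 2) ℂ)ˣ)
    (pull (unitsField (toUField (GaugeField.gaugeAct gJ U))) 0) W u₁ lam hu₁ hsa hW).2
  -- the bond's box lies in `□_{k−1} ⊆ □₀` (print's box law for the split class)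
  have hbox := cubeLamBP'_hbox_pred (d := (F.P K).d) hL1 a M' hρ' (K - n) (K - n) le_rfl (K - n) le_rfl c hc
  have hkk : cubeFam false (F.P K).L a M' ρ' (K - n) (K - n - 1) = cube (F.P K).L a M' ρ' (K - n) (K - n - 1) :=
    cubeFam_false_of_le _ _ _ _ (Nat.sub_le _ _)
  have hy0 : y ∈ cube (F.P K).L a M' ρ' (K - n) 0 := cube_anti (Nat.zero_le _) (Nat.sub_le _ _) (hkk ▸ hbox y hy)
  have hyτ0 : y + e τ ∈ cube (F.P K).L a M' ρ' (K - n) 0 := cube_anti (Nat.zero_le _) (Nat.sub_le _ _) (hkk ▸ hbox (y + e τ) hyτ)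
  rw [← transl_zero_eq_cover]
  exact (gaugeActT_descent_eq_of_mgauge_cube x₀ ha hroomW U gJ (u₁ * gaugeExp lam) _ hWV hy0 τ hyτ0).symm

end Summit.QuantumFields.YangMills.Theorems.HalvingHSiteTopKnitBP

end
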